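import Literature.AnabelianGeometry.SemiGraphs.TemperedDecompositionOfProfinite
import Literature.AnabelianGeometry.EtaleTheta.SettingModelIndependence
import HarnessLib

/-!
# [SemiAnbd] Theorem 6.5: the cuspidal halves of (i) and (ii) follow from the other clauses (interface-level)

Mochizuki, *Semi-graphs of anabelioids*, Publ. RIMS **42** (2006) [SemiAnbd], §6, Theorem 6.5
(Tempered Decomposition Groups), author's manuscript pp. 71–72: (i) «If `x` is a cusp, then `x` is
completely determined by the conjugacy class of the closed subgroup `I_x ⊆ Π^temp_{X_K}`»; (ii) «The
subgroup `D_x` is commensurably terminal in `Π^temp_{X_K}`.  If `x` is a cusp, then `D_x = C_{Π^temp_{X_K}}(H)`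
for any open subgroup `H ⊆ I_x`.» [cite: MochizukiSemiAnbd2006, Thm 6.5 pp.71-72]

PROOF-ONLY companion (abc-iut cell, block F, seat abc-iut-f-174, FACT-LIST row F-1708
`TemperedOrigin.TemperedDecompositionGroupsHolds`; theorems only — no `def`, no `instance`, no new named
fact).  Two of the five typed clauses of Thm. 6.5 (i)(ii)(iv) (`TemperedAnabelian.lean`) are FORMAL
CONSEQUENCES of the others over the §6 interface `TemperedCurve p`, by elementary group theory:

* `commensurator_decomp_eq_of_isCusp`: the second sentence of (ii) (`DecompEqCommensuratorOfOpenInertia`,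
  applied to the open subgroup `H := I_x` of `I_x`) gives `C(I_x) = D_x`, whence the first sentence of (ii)
  AT CUSPS — if `g` commensurates `D_x` then, intersecting with the normal subgroup `Δ^temp_X`, `g`
  commensurates `I_x = D_x ∩ Δ^temp_X`, so `g ∈ C(I_x) = D_x`;
* `inertiaDeterminesCusp_of_decompDeterminesPoint`: the second sentence of (i) (`InertiaDeterminesCusp`)
  from the first (`DecompDeterminesPoint`) and the second sentence of (ii): `I_{x'} = γ I_x γ⁻¹` forces
  `x'` to be a cusp (`I_x ≅ Ẑ(1)` is non-trivial — `Ẑ` is infinite, the tree's `SettingModel.infinite_zHat` —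
  while non-cusps have `I = 1`, interface axioms `inertia_equiv_zHat` / `inertia_eq_bot`), and then
  `D_{x'} = C(I_{x'}) = γ C(I_x) γ⁻¹ = γ D_x γ⁻¹` (`commensurator_conjAct_smul`), so `x' = x`.

Consequently the F-1708 producer `temperedDecompositionGroups_of_profinite` (five [Mzk8] Thm. 1.3 binders
on `Π_{X_K}`) sharpens to FOUR binders, with commensurable terminality asked only for the NON-cuspidal
decomposition groups: `temperedDecompositionGroups_of_profinite₄`,
`TemperedOrigin.temperedDecompositionGroupsHolds_of_profinite₄`.

HONEST FRAMING.  Elementary group theory over the interface; it neither proves nor weakens any clause of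
[SemiAnbd] Thm. 6.5 / [Mzk8] Thm. 1.3 for curves (the non-cuspidal (ii), (i) first sentence and (iv) remain
inputs); nothing here concerns the disputed parts of inter-universal Teichmüller theory or takes a side on
[IUTchIII] Cor. 3.12; typed ≠ proved.
-/

noncomputable section

namespace Literature.AnabelianGeometry.SemiGraphs

open scoped Pointwise
open _root_.Topology
open Subgroup.Commensurable (commensurator)

/-! ### Generic group theory -/

/-- Commensurability passes to intersections with a fixed subgroup: `[K ∩ L : H ∩ K ∩ L] ≤ [K : H ∩ K]`.
[cite: MochizukiSemiAnbd2006, Thm 6.5(ii) p.71] -/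
theorem commensurable_inf_right_of_commensurable {G : Type*} [Group G] {H K : Subgroup G}
    (h : Subgroup.Commensurable H K) (L : Subgroup G) : Subgroup.Commensurable (H ⊓ L) (K ⊓ L) := by
  have key : ∀ {A B : Subgroup G}, A.relIndex B ≠ 0 → (A ⊓ L).relIndex (B ⊓ L) ≠ 0 := by
    intro A B hAB
    refine Subgroup.relIndex_inf_ne_zero ?_ ?_
    · exact fun h0 => hAB (Subgroup.relIndex_eq_zero_of_le_right inf_le_left h0)
    · rw [Subgroup.relIndex_eq_one.mpr inf_le_right]
      exact one_ne_zero
  exact ⟨key h.1, key h.2⟩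

/-- `C(γ A γ⁻¹) = γ C(A) γ⁻¹`: the commensurator of a conjugate is the conjugate of the commensurator.
[cite: MochizukiSemiAnbd2006, Thm 6.5(ii) p.71] -/
theorem commensurator_conjAct_smul {G : Type*} [Group G] (γ : ConjAct G) (A : Subgroup G) :
    commensurator (γ • A) = γ • commensurator A := by
  ext x
  rw [Subgroup.Commensurable.commensurator_mem_iff, Subgroup.mem_pointwise_smul_iff_inv_smul_mem,
    ← mul_smul, Subgroup.Commensurable.commensurable_conj γ⁻¹, ← mul_smul, ← mul_smul,
    inv_mul_cancel, one_smul]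
  have hx : γ⁻¹ * (ConjAct.toConjAct x * γ) = ConjAct.toConjAct (γ⁻¹ • x) := by
    simp [ConjAct.smul_def, mul_assoc]
  rw [hx, ← Subgroup.Commensurable.commensurator_mem_iff]

namespace TemperedCurve

variable {p : ℕ} [Fact p.Prime] (X : TemperedCurve p)

/-! ### The cuspidal inertia is non-trivial; `C(I_x) = D_x` -/

/-- At a cusp, `I_x ≅ Ẑ(1)` is NOT the trivial subgroup (`Ẑ` is infinite: the tree's
`EtaleTheta.SettingModel.infinite_zHat`). [cite: MochizukiSemiAnbd2006, §6 p.71] -/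
theorem inertia_ne_bot_of_isCusp {x : X.Pt} (hx : X.IsCusp x) : X.inertia x ≠ ⊥ := by
  intro hbot
  obtain ⟨e⟩ := X.inertia_equiv_zHat x hx
  haveI : Infinite ZHat := EtaleTheta.SettingModel.infinite_zHat
  obtain ⟨z, hz⟩ := exists_ne (1 : ZHat)
  apply hz
  have hmem : ((e.symm z : ↥(X.decomp x ⊓ X.aug.toMonoidHom.ker)) : X.PiTemp) ∈ X.inertia x :=
    (e.symm z).2
  rw [hbot, Subgroup.mem_bot] at hmem
  have h1 : e.symm z = 1 := Subtype.ext hmem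
  calc z = e (e.symm z) := (e.apply_symm_apply z).symm
    _ = e 1 := by rw [h1]
    _ = 1 := map_one e

/-- The second sentence of Thm. 6.5 (ii) applied to `H := I_x` itself: `C_{Π^temp}(I_x) = D_x` at every cusp.
[cite: MochizukiSemiAnbd2006, Thm 6.5(ii) p.71] -/
theorem commensurator_inertia_eq_decomp (h : X.DecompEqCommensuratorOfOpenInertia) {x : X.Pt}
    (hx : X.IsCusp x) : commensurator (X.inertia x) = X.decomp x := by
  apply h x hx (X.inertia x) le_rfl
  rw [Subgroup.subgroupOf_self, Subgroup.coe_top]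
  exact isOpen_univ

/-! ### (ii), first sentence, at cusps — from (ii), second sentence -/

/-- **Thm. 6.5 (ii), first sentence, AT A CUSP** («`D_x` is commensurably terminal») from the second
sentence (`X.DecompEqCommensuratorOfOpenInertia`): a `g` commensurating `D_x` commensurates
`I_x = D_x ∩ Δ^temp_X` (`Δ^temp_X ⊴ Π^temp` normal), hence lies in `C(I_x) = D_x`.
[cite: MochizukiSemiAnbd2006, Thm 6.5(ii) p.71] -/
theorem commensurator_decomp_eq_of_isCusp (h : X.DecompEqCommensuratorOfOpenInertia) {x : X.Pt}
    (hx : X.IsCusp x) : commensurator (X.decomp x) = X.decomp x := by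
  have hC := X.commensurator_inertia_eq_decomp h hx
  refine le_antisymm ?_ (le_commensurator_self _)
  intro g hg
  rw [← hC, Subgroup.Commensurable.commensurator_mem_iff]
  rw [Subgroup.Commensurable.commensurator_mem_iff] at hg
  have hI : X.inertia x = X.decomp x ⊓ X.DeltaTemp := rfl
  have hN : X.DeltaTemp.Normal := MonoidHom.normal_ker X.aug.toMonoidHom
  rw [hI, Subgroup.smul_inf, hN.conjAct (ConjAct.toConjAct g)]
  exact commensurable_inf_right_of_commensurable hg X.DeltaTemp

/-- **Thm. 6.5 (ii), first sentence, for ALL closed points** from the second sentence (cusps) and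
commensurable terminality of the NON-cuspidal decomposition groups only.
[cite: MochizukiSemiAnbd2006, Thm 6.5(ii) p.71] -/
theorem decompCommensurablyTerminal_of_noncusps (h : X.DecompEqCommensuratorOfOpenInertia)
    (hnc : ∀ x : X.Pt, ¬ X.IsCusp x → commensurator (X.decomp x) = X.decomp x) :
    X.DecompCommensurablyTerminal := fun x => by
  by_cases hx : X.IsCusp x
  · exact X.commensurator_decomp_eq_of_isCusp h hx
  · exact hnc x hx

/-! ### (i), second sentence — from (i), first sentence, and (ii), second sentence -/

/-- **Thm. 6.5 (i), second sentence** («if `x` is a cusp, then `x` is completely determined by the conjugacy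
class of `I_x`»; the typed `X.InertiaDeterminesCusp`) from the FIRST sentence (`X.DecompDeterminesPoint`)
and the second sentence of (ii) (`X.DecompEqCommensuratorOfOpenInertia`): if `I_{x'} = γ I_x γ⁻¹` with `x`
a cusp, then `x'` is a cusp (`I_{x'} ≠ 1`), and `D_{x'} = C(I_{x'}) = γ C(I_x) γ⁻¹ = γ D_x γ⁻¹`, so `x' = x`.
[cite: MochizukiSemiAnbd2006, Thm 6.5(i) p.71] -/
theorem inertiaDeterminesCusp_of_decompDeterminesPoint (h1 : X.DecompDeterminesPoint)
    (h2 : X.DecompEqCommensuratorOfOpenInertia) : X.InertiaDeterminesCusp := by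
  rintro x x' hx ⟨γ, hγ⟩
  by_cases hx' : X.IsCusp x'
  · refine h1 x x' ⟨γ, ?_⟩
    rw [← X.commensurator_inertia_eq_decomp h2 hx', hγ, commensurator_conjAct_smul,
      X.commensurator_inertia_eq_decomp h2 hx]
  · exfalso
    have hbot' : X.inertia x' = ⊥ := X.inertia_eq_bot x' hx'
    apply X.inertia_ne_bot_of_isCusp hx
    calc X.inertia x = γ⁻¹ • (γ • X.inertia x) := (inv_smul_smul γ _).symm
      _ = γ⁻¹ • X.inertia x' := by rw [hγ]
      _ = ⊥ := by rw [hbot', Subgroup.smul_bot]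

/-! ### The F-1708 producer with FOUR [Mzk8] binders -/

/-- **[SemiAnbd] Thm. 6.5 (i), (ii), (iv) for `Π^temp_{X_K}`** (the five typed clauses) from FOUR [Mzk8]
Thm. 1.3 statements on the profinite completion `Π_{X_K}` for `D̂_x = ι(D_x)`, `Î_x = D̂_x ∩ Ker(augHat)`:
(i) first sentence; (ii) first sentence for the NON-cuspidal points only; (ii) second sentence (cusps);
(iv).  The cuspidal halves of (i) and (ii) are formal (`inertiaDeterminesCusp_of_decompDeterminesPoint`,
`commensurator_decomp_eq_of_isCusp`); the transfer along `ι` is `TemperedDecompositionOfProfinite`.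
[cite: MochizukiSemiAnbd2006, Thm 6.5 pp.71-72] -/
theorem temperedDecompositionGroups_of_profinite₄
    (h13i : ∀ x x' : X.Pt, (∃ γ : ConjAct X.PiHat,
        (X.decomp x').map X.toHat.toMonoidHom = γ • (X.decomp x).map X.toHat.toMonoidHom) → x' = x)
    (h13ii_nc : ∀ x : X.Pt, ¬ X.IsCusp x → commensurator ((X.decomp x).map X.toHat.toMonoidHom) =
      (X.decomp x).map X.toHat.toMonoidHom)
    (h13ii' : ∀ x : X.Pt, X.IsCusp x → ∀ H : Subgroup X.PiHat,
      H ≤ (X.decomp x).map X.toHat.toMonoidHom ⊓ X.augHat.toMonoidHom.ker →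
        IsClosed (H : Set X.PiHat) →
          (H.subgroupOf ((X.decomp x).map X.toHat.toMonoidHom ⊓ X.augHat.toMonoidHom.ker)).FiniteIndex →
            commensurator H = (X.decomp x).map X.toHat.toMonoidHom)
    (h13iv : ∀ x x' : X.Pt, ¬ X.IsCusp x → X.IsCusp x' → ∀ γ γ' : ConjAct X.PiHat,
      ¬ (γ • (X.decomp x).map X.toHat.toMonoidHom ≤ γ' • (X.decomp x').map X.toHat.toMonoidHom)) :
    X.DecompDeterminesPoint ∧ X.InertiaDeterminesCusp ∧ X.DecompCommensurablyTerminal ∧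
      X.DecompEqCommensuratorOfOpenInertia ∧ X.NoncuspidalNotLeCuspidal := by
  have hA : X.DecompDeterminesPoint := X.decompDeterminesPoint_of_hat h13i
  have hB : X.DecompEqCommensuratorOfOpenInertia := X.decompEqCommensuratorOfOpenInertia_of_hat h13ii'
  refine ⟨hA, X.inertiaDeterminesCusp_of_decompDeterminesPoint hA hB,
    X.decompCommensurablyTerminal_of_noncusps hB fun x hx =>
      X.commensurator_eq_of_map_toHat (h13ii_nc x hx),
    hB, X.noncuspidalNotLeCuspidal_of_hat h13iv⟩

end TemperedCurve

namespace TemperedOrigin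

open scoped Pointwise
open Subgroup.Commensurable (commensurator)

variable {p : ℕ} [Fact p.Prime]

/-- **[SemiAnbd] Thm. 6.5 (i), (ii), (iv) as printed** (the FACT-LIST row F-1708
`Ω.TemperedDecompositionGroupsHolds`) from FOUR [Mzk8] Thm. 1.3 statements on the profinite completions of
the certified curves — (i) first sentence, (ii) first sentence for non-cuspidal points, (ii) second
sentence, (iv) — the cuspidal halves of (i) and (ii) being formal consequences over the interface.
[cite: MochizukiSemiAnbd2006, Thm 6.5 pp.71-72] -/
theorem temperedDecompositionGroupsHolds_of_profinite₄ (Ω : TemperedOrigin p)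
    (h13 : ∀ X : TemperedCurve p, Ω.IsHyperbolicCurveOrigin X →
      (∀ x x' : X.Pt, (∃ γ : ConjAct X.PiHat,
        (X.decomp x').map X.toHat.toMonoidHom = γ • (X.decomp x).map X.toHat.toMonoidHom) → x' = x) ∧
      (∀ x : X.Pt, ¬ X.IsCusp x → commensurator ((X.decomp x).map X.toHat.toMonoidHom) =
        (X.decomp x).map X.toHat.toMonoidHom) ∧
      (∀ x : X.Pt, X.IsCusp x → ∀ H : Subgroup X.PiHat,
        H ≤ (X.decomp x).map X.toHat.toMonoidHom ⊓ X.augHat.toMonoidHom.ker →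
          IsClosed (H : Set X.PiHat) →
            (H.subgroupOf ((X.decomp x).map X.toHat.toMonoidHom ⊓ X.augHat.toMonoidHom.ker)).FiniteIndex →
              commensurator H = (X.decomp x).map X.toHat.toMonoidHom) ∧
      (∀ x x' : X.Pt, ¬ X.IsCusp x → X.IsCusp x' → ∀ γ γ' : ConjAct X.PiHat,
        ¬ (γ • (X.decomp x).map X.toHat.toMonoidHom ≤ γ' • (X.decomp x').map X.toHat.toMonoidHom))) :
    Ω.TemperedDecompositionGroupsHolds := fun X hX => by
  obtain ⟨h1, h2, h2', h4⟩ := h13 X hX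
  exact X.temperedDecompositionGroups_of_profinite₄ h1 h2 h2' h4

end TemperedOrigin

end Literature.AnabelianGeometry.SemiGraphs

end
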